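import Summits.BirchSwinnertonDyer.BirchSwinnertonDyer.Theorems.ThetaPartnerAtTwoSignedControlAtTwoSignedLocalInjModP
import Summits.BirchSwinnertonDyer.BirchSwinnertonDyer.Theorems.ThetaPartnerAtTwoSignedControlAtTwoPlusLocalInjOfLift
import Literature.NumberTheory.EllipticCurves.Sprung2012.LocalTowerLayersProofs
import HarnessLib

/-!
# INJ⁺@2 (registered stub `stub_plusLocalInjTwo` of K4 `SignedControlAtTwo`, stmt-BirchSwinnertonDyer-20309, line `eulerchar`
# v4) ⟸ «`E⁺(ℚ_{2,n})/2` is MONOGENIC over `ℤ[Γ_{ℚ₂}]` for every `n`» (CYC⁺@2, Kobayashi Prop. 8.12 i) read at `2`) + «`E(ℚ₂) ⊄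
# 2E(ℚ₂)`» (LEV0@2) — the assembly: (LIFT) from the MOD-`p` criterion at every layer by induction on `k`

Route `ThetaPartnerAtTwo` (TP2; crux shared with RTT), crux K4, line `eulerchar` v4 (lead `prover-bsd-wall-tp2-p3`); seat
`prover-bsd-wall-tp2-p3-w3` (width seat 3/3). Sequel of `…SignedLocalInjSocle` (algebra), `…SignedLocalInjModP` (MOD-`p` ⟸ CYC)
and `…PlusLocalInjOfLift` (INJ⁺@2 ⟸ LIFT⁺@2).

WHAT.
* §4 (any `K`, `p`, `κ`, `ι`, `ε`) `invariantsLift_of_modP` — (LIFT) for `A^ε = ⨆ₙ E^ε(K_n·K_v)` («`x ∈ A^ε`, `σx − x ∈ p^k M ∀σ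
  ⇒ x ∈ p^k M + E(K_v)`») from its `k = 1` case at every layer (MOD-`p`) under (NT), by induction on `k` — elementwise
  «`H¹(G, E^ε_n)[p] = 0 ⇒ H¹(G, E^ε_n) = 0`»; `invariantsLift_of_cyclic` — (LIFT) ⟸ (NT) + (CYC at every `n`) + (LEV0).
* §5 (`K = ℚ`, `p = 2`, `ε = 1`) `plusLocalInj_two_of_cyclicModTwo` — at a good supersingular `2` ((NT) is the tree theorem
  `SSFlatEC.eq_zero_of_mem_localTowerPointsOfEmb_of_two_nsmul`): INJ⁺@2 for one `W`, `κ`, `v ∋ 2` ⟸ (CYC⁺@2) + (LEV0@2); and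
  **`stub_plusLocalInjTwo_of_cyclicModTwo` — the registered stub VERBATIM ⟸ (CYC⁺@2) + (LEV0@2) quantified over the sub-row.**

NET (for the planner / the lead / the local item promoted from `stub_plusLocalInjTwo`): the READ-AT-2 residue of K4 on the INJ
side is now, in the kernel, exactly
  (CYC⁺@2) `∀ n, ∃ d ∈ E⁺(ℚ_n·ℚ₂), E⁺(ℚ_n·ℚ₂) = ℤ[Γ_{ℚ₂}]·d + 2·E⁺(ℚ_n·ℚ₂)` — Kobayashi Prop. 8.12 i) at `2` for the `ℤ₂`-tower
  (the trace-compatible Honda point `d_n`, Sprung 2012 Thm. 2.2 (2′) traced, generates) —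
plus the elementary (LEV0@2) `E(ℚ₂) ⊄ 2·E(ℚ₂)`. Equivalent formulations (all ⟺ `H¹(Gal(ℚ_{2,n}/ℚ₂), E⁺(ℚ_{2,n})) = 0` for all
`n`): MOD2⁺ (the `Γ`-invariants of `E⁺_n/2E⁺_n` are the line of `E(ℚ₂)`), LIFT⁺@2 (`(E⁺_∞ ⊗ ℚ₂/ℤ₂)^Γ = E(ℚ₂) ⊗ ℚ₂/ℤ₂`), `D⁺ = 0`
(lead's dossier LAGPLUS-AT-2; kit: trivial for `n ≤ 7`; the odd sign has `D⁻ ≅ ℤ/4`, so the sign matters at `2`).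

HONEST FRAMING: THEOREMS ONLY (no definition, no named fact, no `sorry`), route-independent (no `Theses` import); nothing about
any curve is asserted beyond the displayed hypotheses; closes no item (the stub stays open: (CYC⁺@2) is its research content);
BSD is not proved by any of this.

References: [Kobayashi2003] S. Kobayashi, Invent. Math. 152 (2003), Def. 1.1, Props. 8.7, 8.12, 8.23, Thm. 9.3; [BDKim2013]
B. D. Kim, J. Aust. Math. Soc. 95 (2013), proof of Cor. 3.15 (p. 199); [Sprung2012] F. Sprung, J. Number Theory 132 (2012),
Lemma 2.3, Thm. 2.2; [KuriharaOtsuki2006] M. Kurihara, R. Otsuki, PAMQ 2 (2006), p. 557.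
-/

set_option autoImplicit false
-- the Theorems namespace of this sub repeats the summit name by design (D-0017 nested layout)
set_option linter.dupNamespace false

noncomputable section

open scoped Classical

namespace Summit.BirchSwinnertonDyer.BirchSwinnertonDyer.Theorems.SignedEC

/-! ## §4 (LIFT) from its `k = 1` case layerwise (the MOD-`p` criterion), by induction on `k` -/

section Lift

open Literature.NumberTheory.EllipticCurves Literature.NumberTheory.GaloisRepresentations
  WeierstrassCurve ZpExtension Literature.NumberTheory.EllipticCurves.Kobayashi2003
  Literature.NumberTheory.EllipticCurves.Sprung2012 Summit.BirchSwinnertonDyer.Rank1Residual.Additive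

universe u

variable {K : Type u} [Field K] (W : WeierstrassCurve K) {p : ℕ} [Fact p.Prime] (κ : ZpExtension K p)
  {E : Type u} [Field E] [Algebra K E] (ι : AlgebraicClosure K →ₐ[K] AlgebraicClosure E)

/-- **(LIFT) for `A^ε = ⨆ₙ E^ε(K_n·K_v)` from the MOD-`p` criterion at every layer.** Let `M = E(K_∞·K_v)` have no
`p`-torsion (NT) and suppose that for every `n`, every `x ∈ E^ε(K_n·K_v)` whose class in `M/pM` is `Γ_{K_v}`-invariant
lies in `pM + E(K_v)` (MOD-`p`, the `k = 1` case). THEN for every `x ∈ ⨆ₙ E^ε(K_n·K_v)` and every `k`: if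
`σx − x ∈ p^k M` for all `σ` then `x ∈ p^k M + E(K_v)`. Induction on `k`: write `x = p^k R + x₀` by the inductive
hypothesis; then `p^k(σR − R) = σx − x ∈ p^{k+1} M` gives `σR − R ∈ pM` (no torsion), `R ∈ E^ε(K_n·K_v)` by saturation
(`mem_signedLocalPointsOfEmb_of_pow_nsmul_mem`), so `R = pR' + r₀` and `x = p^{k+1} R' + (p^k r₀ + x₀)`. (This is
`H¹(G, E^ε_n)[p] = 0 ⇒ H¹(G, E^ε_n) = 0` for the finite `p`-group `H¹`, elementwise.)
[cite: Kobayashi2003, Def. 1.1 (p. 2), §2 p. 4] [cite: BDKim2013, proof of Cor. 3.15 (p. 199)] -/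
theorem invariantsLift_of_modP (hnt : ∀ P ∈ localTowerPointsOfEmb κ ι W, p • P = 0 → P = 0) (ε : ℤˣ)
    (hmod : ∀ n : ℕ, ∀ x ∈ signedLocalPointsOfEmb κ ι W ε n,
      (∀ σ : Field.absoluteGaloisGroup E, ∃ w ∈ localTowerPointsOfEmb κ ι W, σ • x - x = p • w) →
      ∃ R ∈ localTowerPointsOfEmb κ ι W, x - p • R ∈ localLayerPointsOfEmb κ ι W 0) :
    ∀ x ∈ (⨆ n, signedLocalPointsOfEmb κ ι W ε n), ∀ k : ℕ,
      (∀ σ : Field.absoluteGaloisGroup E, ∃ w ∈ localTowerPointsOfEmb κ ι W, σ • x - x = p ^ k • w) →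
      ∃ R ∈ localTowerPointsOfEmb κ ι W, x - p ^ k • R ∈ localLayerPointsOfEmb κ ι W 0 := by
  intro x hx
  obtain ⟨n, hxn⟩ := (AddSubgroup.mem_iSup_of_directed
    (signedLocalPointsOfEmb_mono κ ι W ε).directed_le).1 hx
  have h0fix : ∀ m ∈ localLayerPointsOfEmb κ ι W 0, ∀ σ : Field.absoluteGaloisGroup E, σ • m = m :=
    fun m hm σ ↦ (mem_localLayerPointsOfEmb_zero_iff κ ι W m).1 hm σ
  have hAM : signedLocalPointsOfEmb κ ι W ε n ≤ localTowerPointsOfEmb κ ι W :=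
    (signedLocalPointsOfEmb_le κ ι W ε n).trans (localLayerPointsOfEmb_le_localTowerPointsOfEmb κ ι W n)
  have h0A : localLayerPointsOfEmb κ ι W 0 ≤ signedLocalPointsOfEmb κ ι W ε n :=
    localLayerPointsOfEmb_zero_le_signedLocalPointsOfEmb κ ι W ε n
  -- induction on `k`, for all points of the layer
  suffices key : ∀ k : ℕ, ∀ y ∈ signedLocalPointsOfEmb κ ι W ε n,
      (∀ σ : Field.absoluteGaloisGroup E, ∃ w ∈ localTowerPointsOfEmb κ ι W, σ • y - y = p ^ k • w) →
      ∃ R ∈ localTowerPointsOfEmb κ ι W, y - p ^ k • R ∈ localLayerPointsOfEmb κ ι W 0 from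
    fun k ↦ key k x hxn
  intro k
  induction k with
  | zero =>
    intro y hy _
    exact ⟨y, hAM hy, by rw [pow_zero, one_smul, sub_self]; exact zero_mem _⟩
  | succ k ih =>
    intro y hy hinv
    -- inductive hypothesis at `k`
    obtain ⟨R, hRM, hx₀⟩ := ih y hy (fun σ ↦ by
      obtain ⟨w, hw, hσ⟩ := hinv σ
      exact ⟨p • w, AddSubgroup.nsmul_mem _ hw _, by rw [hσ, pow_succ, mul_smul]⟩)
    -- `R ∈ E^ε_n`
    have hRA : R ∈ signedLocalPointsOfEmb κ ι W ε n := by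
      refine mem_signedLocalPointsOfEmb_of_pow_nsmul_mem W κ ι hnt ε n (k := k) hRM ?_
      have e : p ^ k • R = y - (y - p ^ k • R) := by abel
      rw [e]; exact sub_mem hy (h0A hx₀)
    -- `σR − R ∈ pM`
    have hRinv : ∀ σ : Field.absoluteGaloisGroup E, ∃ w ∈ localTowerPointsOfEmb κ ι W, σ • R - R = p • w := by
      intro σ
      obtain ⟨w, hw, hσ⟩ := hinv σ
      refine ⟨w, hw, ?_⟩
      have h1 : p ^ k • (σ • R - R - p • w) = 0 := by
        have e1 : p ^ k • (σ • R - R) = σ • y - y := by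
          rw [smul_sub, ← galois_smul_nsmul_modP]
          have e2 : p ^ k • R = y - (y - p ^ k • R) := by abel
          rw [e2, smul_sub σ y, h0fix _ hx₀ σ]; abel
        rw [smul_sub, e1, hσ, pow_succ, mul_smul, sub_self]
      have h2 : σ • R - R - p • w ∈ localTowerPointsOfEmb κ ι W :=
        sub_mem (sub_mem (smul_mem_localTowerPointsOfEmb κ ι W σ hRM) hRM) (AddSubgroup.nsmul_mem _ hw _)
      exact sub_eq_zero.1 (Sprung2012.eq_zero_of_pow_nsmul_eq_zero_of_noPTorsion κ ι W hnt h2 h1)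
    obtain ⟨R', hR'M, hr₀⟩ := hmod n R hRA hRinv
    refine ⟨R', hR'M, ?_⟩
    have e : y - p ^ (k + 1) • R' = (y - p ^ k • R) + p ^ k • (R - p • R') := by
      rw [pow_succ, mul_smul, smul_sub]; abel
    rw [e]
    exact add_mem hx₀ (AddSubgroup.nsmul_mem _ hr₀ _)

/-- **(LIFT) for Kobayashi's signed points from (NT) + monogenicity mod `p` at every layer (CYC) + a non-`p`-divisible
point of `E(K_v)` (LEV0)** — the composition of `modP_of_cyclic` (with the generator supplied by
`exists_forall_smul_eq_pow_smul`) and `invariantsLift_of_modP`. [cite: Kobayashi2003, Prop. 8.12 (pp. 17–18)]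
[cite: BDKim2013, proof of Cor. 3.15 (p. 199)] -/
theorem invariantsLift_of_cyclic (hnt : ∀ P ∈ localTowerPointsOfEmb κ ι W, p • P = 0 → P = 0) (ε : ℤˣ)
    (hlev : ∃ m₀ ∈ localLayerPointsOfEmb κ ι W 0, ∀ b ∈ localLayerPointsOfEmb κ ι W 0, m₀ ≠ p • b)
    (hcyc : ∀ n : ℕ, ∃ d ∈ signedLocalPointsOfEmb κ ι W ε n, ∀ x ∈ signedLocalPointsOfEmb κ ι W ε n,
      ∃ B ∈ AddSubgroup.closure (Set.range fun σ : Field.absoluteGaloisGroup E ↦ σ • d),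
        ∃ b ∈ signedLocalPointsOfEmb κ ι W ε n, x = B + p • b) :
    ∀ x ∈ (⨆ n, signedLocalPointsOfEmb κ ι W ε n), ∀ k : ℕ,
      (∀ σ : Field.absoluteGaloisGroup E, ∃ w ∈ localTowerPointsOfEmb κ ι W, σ • x - x = p ^ k • w) →
      ∃ R ∈ localTowerPointsOfEmb κ ι W, x - p ^ k • R ∈ localLayerPointsOfEmb κ ι W 0 := by
  refine invariantsLift_of_modP W κ ι hnt ε fun n ↦ ?_
  obtain ⟨g, hg⟩ := exists_forall_smul_eq_pow_smul W κ ι n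
  exact modP_of_cyclic W κ ι hnt ε n g hg (hcyc n) hlev

end Lift

/-! ## §5 `K = ℚ`, `p = 2`, `ε = 1`: INJ⁺@2 ⟸ (CYC⁺@2) + (LEV0@2) -/

section Two

open Literature.NumberTheory.EllipticCurves Literature.NumberTheory.GaloisRepresentations
  WeierstrassCurve ZpExtension Literature.NumberTheory.EllipticCurves.Kobayashi2003
  Literature.NumberTheory.EllipticCurves.Sprung2012

open scoped NumberField

open NumberField IsDedekindDomain

variable (W : WeierstrassCurve ℚ) [W.IsElliptic] [W.IsGloballyMinimal]

/-- **INJ⁺@2 for one curve, one `ℤ₂`-extension and the place above `2`, from monogenicity mod `2`.** At a good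
supersingular `2` (so `E(ℚ_∞·ℚ₂)` has no `2`-torsion, `SSFlatEC.eq_zero_of_mem_localTowerPointsOfEmb_of_two_nsmul`):
ASSUME (LEV0@2) `E(ℚ_v)` has a point not in `2·E(ℚ_v)` and (CYC⁺@2) for every `n`, Kobayashi's `E⁺(ℚ_n·ℚ_v)` is
generated modulo `2·E⁺(ℚ_n·ℚ_v)` by the `Γ_{ℚ_v}`-conjugates of ONE of its points (Kobayashi Prop. 8.12 i) read at `2`:
the traced Honda point). THEN every `y ∈ H¹(ℚ, E[2^∞])` with `h_0 y ∈ Sel⁺(E/ℚ_∞)` is classically Selmer at `2`.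
[cite: Kobayashi2003, Prop. 8.12 (pp. 17–18), Thm. 9.3 (p. 26)] [cite: BDKim2013, proof of Cor. 3.15 (p. 199)]
[cite: Sprung2012, Lemma 2.3 (p. 1487)] -/
theorem plusLocalInj_two_of_cyclicModTwo (hss : Rank1Residual.GoodSS W 2) (κ : ZpExtension ℚ 2)
    (v : HeightOneSpectrum (𝓞 ℚ)) (hv : (2 : 𝓞 ℚ) ∈ v.asIdeal)
    (hlev : ∃ m₀ ∈ localLayerPointsOfEmb κ (closureEmb (K := ℚ) (v.adicCompletion ℚ)) W 0,
      ∀ b ∈ localLayerPointsOfEmb κ (closureEmb (K := ℚ) (v.adicCompletion ℚ)) W 0, m₀ ≠ 2 • b)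
    (hcyc : ∀ n : ℕ, ∃ d ∈ signedLocalPoints κ (v.adicCompletion ℚ) W 1 n,
      ∀ x ∈ signedLocalPoints κ (v.adicCompletion ℚ) W 1 n,
      ∃ B ∈ AddSubgroup.closure (Set.range fun σ : Field.absoluteGaloisGroup (v.adicCompletion ℚ) ↦ σ • d),
        ∃ b ∈ signedLocalPoints κ (v.adicCompletion ℚ) W 1 n, x = B + 2 • b) :
    ∀ y ∈ (signedSelmerInfty W κ 1).comap (W.layerToInfty κ 0),
      W.localResOver 2 (κ.layerSubgroup 0) (v.adicCompletion ℚ) y = 0 := by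
  have hnt : ∀ P ∈ localTowerPointsOfEmb κ (closureEmb (K := ℚ) (v.adicCompletion ℚ)) W, 2 • P = 0 → P = 0 :=
    fun P hP h2 ↦ SSFlatEC.eq_zero_of_mem_localTowerPointsOfEmb_of_two_nsmul W hss κ (by exact_mod_cast hv) _ hP h2
  exact plusLocalInj_two_of_invariantsLift W hss κ v hv
    (invariantsLift_of_cyclic W κ (closureEmb (K := ℚ) (v.adicCompletion ℚ)) hnt 1 hlev hcyc)

/-- **The registered stub `stub_plusLocalInjTwo` (INJ⁺@2) of line `eulerchar` v4 ⟸ (CYC⁺@2) + (LEV0@2) over the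
sub-row.** If for every `W/ℚ` on the sub-row `¬CM, r_an = 0, GoodSS 2, a₂ = 0`, every cyclotomic `ℤ₂`-extension `κ` and the
place `v ∋ 2`: `E(ℚ_v)` carries a point not divisible by `2` in `E(ℚ_v)`, and for every `n` the group `E⁺(ℚ_n·ℚ_v)` is
MONOGENIC over `ℤ[Γ_{ℚ_v}]` modulo `2·E⁺(ℚ_n·ℚ_v)` — then the stub's statement holds verbatim. The displayed hypotheses are
the local `±`-theory at `2` in its Kobayashi Prop. 8.12 form (generation by the trace-compatible Honda point), equivalent
layerwise to `H¹(Gal(ℚ_{2,n}/ℚ₂), E⁺(ℚ_{2,n})) = 0`. [cite: Kobayashi2003, Props. 8.12, 8.23, Thm. 9.3 (odd p)]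
[cite: BDKim2013, proof of Cor. 3.15 (p. 199)] [cite: KuriharaOtsuki2006, p. 557] -/
theorem stub_plusLocalInjTwo_of_cyclicModTwo
    (hLEV : ∀ (W : WeierstrassCurve ℚ) [W.IsElliptic] [W.IsGloballyMinimal],
      ¬ W.HasCM → W.analyticRank = 0 → Rank1Residual.GoodSS W 2 → W.frobeniusTrace 2 = 0 →
      ∀ (κ : ZpExtension ℚ 2), κ.IsCyclotomic →
      ∀ (v : HeightOneSpectrum (𝓞 ℚ)), (2 : 𝓞 ℚ) ∈ v.asIdeal →
      ∃ m₀ ∈ localLayerPointsOfEmb κ (closureEmb (K := ℚ) (v.adicCompletion ℚ)) W 0,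
        ∀ b ∈ localLayerPointsOfEmb κ (closureEmb (K := ℚ) (v.adicCompletion ℚ)) W 0, m₀ ≠ 2 • b)
    (hCYC : ∀ (W : WeierstrassCurve ℚ) [W.IsElliptic] [W.IsGloballyMinimal],
      ¬ W.HasCM → W.analyticRank = 0 → Rank1Residual.GoodSS W 2 → W.frobeniusTrace 2 = 0 →
      ∀ (κ : ZpExtension ℚ 2), κ.IsCyclotomic →
      ∀ (v : HeightOneSpectrum (𝓞 ℚ)), (2 : 𝓞 ℚ) ∈ v.asIdeal →
      ∀ n : ℕ, ∃ d ∈ signedLocalPoints κ (v.adicCompletion ℚ) W 1 n,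
        ∀ x ∈ signedLocalPoints κ (v.adicCompletion ℚ) W 1 n,
        ∃ B ∈ AddSubgroup.closure (Set.range fun σ : Field.absoluteGaloisGroup (v.adicCompletion ℚ) ↦ σ • d),
          ∃ b ∈ signedLocalPoints κ (v.adicCompletion ℚ) W 1 n, x = B + 2 • b) :
    ∀ (W : WeierstrassCurve ℚ) [W.IsElliptic] [W.IsGloballyMinimal],
      ¬ W.HasCM → W.analyticRank = 0 → Rank1Residual.GoodSS W 2 → W.frobeniusTrace 2 = 0 →
      ∀ (κ : ZpExtension ℚ 2), κ.IsCyclotomic →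
      ∀ (v : HeightOneSpectrum (𝓞 ℚ)), (2 : 𝓞 ℚ) ∈ v.asIdeal →
      ∀ y ∈ (signedSelmerInfty W κ 1).comap (W.layerToInfty κ 0),
        W.localResOver 2 (κ.layerSubgroup 0) (v.adicCompletion ℚ) y = 0 :=
  fun W _ _ hcm hr hss ha κ hκ v hv ↦
    plusLocalInj_two_of_cyclicModTwo W hss κ v hv (hLEV W hcm hr hss ha κ hκ v hv) (hCYC W hcm hr hss ha κ hκ v hv)

end Two

end Summit.BirchSwinnertonDyer.BirchSwinnertonDyer.Theorems.SignedEC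

end
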